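import Literature.NumberTheory.EllipticCurves.ImaginaryPeriod
import Literature.NumberTheory.EllipticCurves.RealPeriod
import HarnessLib

/-!
# Pal's period relation for a quadratic twist by `d > 0`, proved with the scaling explicit: `Ω(Wd)·√d = |u(C)|·Ω(V)` (cell `b2b-bsdres`, seat additive-p4, line V9)

HONEST FRAMING (cell `b2b-bsdres`, run/shared/lean/b2b/bsd-rank1-residual/, verbatim in every
file): the goal of the cell is to DELETE the COMBINATION-SHAPED residual classes of the
Birch–Swinnerton-Dyer formula for ALL analytic-rank `≤ 1` elliptic curves over `ℚ` — "full BSD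
formula for every rank `≤ 1` curve in class `C`" assembled STRICTLY from published theorems — so
that the rank-`≤ 1` remainder becomes exactly the CONSTRUCTION-SHAPED classes, which are TYPED
(missing-input `Prop`s), NOT attempted. This is not "finishing BSD". The additive sub-cell (seats
additive-p1…p4) is a RESEARCH ROUTE on the construction-shaped classes X3/X4; no claim beyond the
stated classes; the label of X3 is UNCHANGED.

Theorems only (no definition, no named fact). Twin, for `d > 0`, of the literature seat's
`realPeriodRat_mul_sqrt_of_twist_of_neg` (`ImaginaryPeriod.lean`, `d < 0`): V. Pal, *Periods of
quadratic twists of elliptic curves*, Proc. AMS 140 (2012), Thm. 3.2 — "if `d > 0`, then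
`Ω(E^d) = (ũ/√d)·Ω(E)`" — with Pal's rational factor `ũ` made EXPLICIT as `|u(C)|` for the change
of variables `C` from the tree's twisted model `V^{(d)} = V.quadraticTwist d` to the model `Wd`:
for ANY `V/ℚ`, `d > 0`, `Wd = C • V^{(d)}`: **`Ω(Wd)·√d = |u(C)|·Ω(V)`**
(`realPeriodRat_mul_sqrt_of_twist_of_pos`). Over `ℝ` the twist by `d = (√d)²` IS a change of
variables (`u = 1/√d`, after completing the square with `u = 1`: the explicit forms
`completeSquare_smul_eq_quadraticTwist_one`, `rescale_smul_quadraticTwist` of the tree's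
`exists_variableChange_quadraticTwist_one` / `…_mul_sq`), and `Ω(C • X) = |u|·Ω(X)` (tree theorem
`realPeriod_smul_holds`, Silverman *AEC* III.1 Table 3.1). Pal's `p`-adic claim `u_p = 1` for a
`p`-semistable minimal `V` and `d = ±p` is the tree theorem `padicValRat_u_eq_zero_of_twist_pm_p`
(`RamifiedTwistMinimality.lean`). Consumer: `X3RankZeroSemistableTwistFactFree.lean`.

References: Pal 2012 [Pal2012] Thm. 3.2, Lemma 3.1; Silverman *AEC* [SilvermanAEC2009] III.1
Table 3.1, X.2 Prop. 2.4.
-/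

noncomputable section

open scoped Classical

open WeierstrassCurve Literature.NumberTheory.EllipticCurves

namespace Summit.BirchSwinnertonDyer.Rank1Residual.Additive

/-! ## Pal's period relation for `d > 0`, proved -/

section PeriodPos

/-- Over a field of characteristic `≠ 2`: the explicit change of variables `(1, 0, −a₁/2, −a₃/2)`
(completing the square) carries `X` to its "twist by `1`" (`exists_variableChange_quadraticTwist_one`
with the change of variables named, so that its `u = 1` is visible). -/
theorem completeSquare_smul_eq_quadraticTwist_one {F : Type*} [Field F] [NeZero (2 : F)]
    (X : WeierstrassCurve F) :
    (⟨1, 0, -X.a₁ / 2, -X.a₃ / 2⟩ : VariableChange F) • X = X.quadraticTwist 1 := by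
  have h2 : (2 : F) ≠ 0 := two_ne_zero
  have h4 : (4 : F) ≠ 0 := by
    rw [show (4 : F) = 2 * 2 by norm_num]
    exact mul_ne_zero h2 h2
  ext
  · simp only [variableChange_a₁, quadraticTwist_a₁, inv_one, Units.val_one]
    field_simp
    ring
  · simp only [variableChange_a₂, quadraticTwist_a₂, b₂, inv_one, Units.val_one]
    field_simp
    ring
  · simp only [variableChange_a₃, quadraticTwist_a₃, inv_one, Units.val_one]
    field_simp
    ring
  · simp only [variableChange_a₄, quadraticTwist_a₄, b₄, inv_one, Units.val_one]
    field_simp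
    ring
  · simp only [variableChange_a₆, quadraticTwist_a₆, b₆, inv_one, Units.val_one]
    field_simp
    ring

/-- The explicit rescaling `(e⁻¹, 0, 0, 0)` carries the twist by `d` to the twist by `d e²`
(`exists_variableChange_quadraticTwist_mul_sq` with the change of variables named). -/
theorem rescale_smul_quadraticTwist {F : Type*} [Field F] (X : WeierstrassCurve F) (d e : F)
    (he : e ≠ 0) :
    (⟨(Units.mk0 e he)⁻¹, 0, 0, 0⟩ : VariableChange F) • X.quadraticTwist d =
      X.quadraticTwist (d * e ^ 2) := by
  ext
  · simp [variableChange_a₁]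
  · simp only [variableChange_a₂, quadraticTwist_a₂, quadraticTwist_a₁, inv_inv, Units.val_mk0]
    ring
  · simp [variableChange_a₃]
  · simp only [variableChange_a₄, quadraticTwist_a₁, quadraticTwist_a₂, quadraticTwist_a₃,
      quadraticTwist_a₄, inv_inv, Units.val_mk0]
    ring
  · simp only [variableChange_a₆, quadraticTwist_a₁, quadraticTwist_a₂, quadraticTwist_a₃,
      quadraticTwist_a₄, quadraticTwist_a₆, inv_inv, Units.val_mk0]
    ring

/-- Over `ℝ`, for `D > 0`: `Ω(X^{(D)}) · √D = Ω(X)` — the twist by a positive real is the change of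
variables `u = 1/√D` (composed with completing the square, `u = 1`), and `Ω(C • X) = |u|·Ω(X)`
(tree theorem `realPeriod_smul_holds`, Silverman *AEC* III.1 Table 3.1). -/
theorem realPeriod_quadraticTwist_mul_sqrt_of_pos (X : WeierstrassCurve ℝ) {D : ℝ} (hD : 0 < D) :
    (X.quadraticTwist D).realPeriod * Real.sqrt D = X.realPeriod := by
  set e : ℝ := Real.sqrt D with he
  have he0 : e ≠ 0 := Real.sqrt_ne_zero'.mpr hD
  have he2 : (1 : ℝ) * e ^ 2 = D := by rw [one_mul, he, Real.sq_sqrt hD.le]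
  have h1 := completeSquare_smul_eq_quadraticTwist_one X
  have h2 := rescale_smul_quadraticTwist X 1 e he0
  rw [he2] at h2
  have hA := ((⟨1, 0, -X.a₁ / 2, -X.a₃ / 2⟩ : VariableChange ℝ) • X).realPeriod_smul_holds
    ⟨(Units.mk0 e he0)⁻¹, 0, 0, 0⟩
  have hB := X.realPeriod_smul_holds ⟨1, 0, -X.a₁ / 2, -X.a₃ / 2⟩
  rw [← h2, ← h1, hA, hB]
  have hepos : 0 < e := Real.sqrt_pos.mpr hD
  simp only [Units.val_inv_eq_inv_val, Units.val_mk0, Units.val_one, abs_one, one_mul, abs_inv,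
    abs_of_pos hepos]
  field_simp

end PeriodPos

/-- **Pal 2012, Thm. 3.2 for `d > 0`, PROVED with the scaling explicit**: for `V/ℚ`, `d > 0` and ANY
model `Wd = C • V^{(d)}` of the twist over `ℚ` (e.g. a globally minimal one):
`Ω(Wd) · √d = |u(C)| · Ω(V)` (`Ω = realPeriodRat`, all real components). Pal's `ũ` is this `|u(C)|`
for minimal `V`, `Wd` (his Prop. 2.5 / Cor. 2.6 compute it; the tree's `p`-adic part is
`padicValRat_u_eq_zero_of_twist_pm_p`). Twin of the tree's `realPeriodRat_mul_sqrt_of_twist_of_neg`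
(`d < 0`). -/
theorem realPeriodRat_mul_sqrt_of_twist_of_pos (V : WeierstrassCurve ℚ) {d : ℚ} (hd : 0 < d)
    (Wd : WeierstrassCurve ℚ) (C : VariableChange ℚ) (hC : C • V.quadraticTwist d = Wd) :
    Wd.realPeriodRat * Real.sqrt d = |((C.u : ℚ) : ℝ)| * V.realPeriodRat := by
  subst hC
  have hdR : (0 : ℝ) < (d : ℝ) := by exact_mod_cast hd
  rw [(V.quadraticTwist d).realPeriodRat_smul_holds C, mul_assoc,
    WeierstrassCurve.realPeriodRat_def (V.quadraticTwist d), V.baseChange_real_quadraticTwist,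
    realPeriod_quadraticTwist_mul_sqrt_of_pos (V.baseChange ℝ) hdR,
    ← WeierstrassCurve.realPeriodRat_def]

end Summit.BirchSwinnertonDyer.Rank1Residual.Additive

end
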